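import Summits.KontsevichZagierPeriods.Zeta5Search.WedgeDictionaryLevelDescentInduction
import Summits.KontsevichZagierPeriods.Zeta5Search.WedgeDictionaryLevelDescentFaceUValue
import HarnessLib

/-!
# Level descent (LD@N) for `W` and `V`: the theorems (cell `pub-zeta5`, gen-1 g7)

HONEST FRAMING: systematic search; no irrationality claim unless certified.

Assembly of the kernel proof of the level-descent identities of `…WedgeDictionaryLevelDescent` (T1, FROZEN statements):
`levelDescentWV_of_faceExt_holds : coeffU_faceExt_stmt → levelDescentW ∧ levelDescentV` (`…LevelDescentInduction`: region `RW`,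
middle-mover induction on `φ = N − max pair sum`, bases = the extended face `b₁ + b₂ = N` and its `S₃`-transports, level `N = 0`)
and `coeffU_faceExt_holds : coeffU_faceExt_stmt` (`…LevelDescentFaceUValue`: the value of `U` on the extended face) give
**`levelDescentW_holds : levelDescentW`** and **`levelDescentV_holds : levelDescentV`** (and the box forms `ldBoxW`, `ldBoxV`), with no hypothesis.
What this is NOT: `levelDescentVFull` (the `b₁ + b₂ + b₇ > N` boundary-corrected `V` identity) is untouched; nothing here bears on irrationality.
-/

namespace Summit.KontsevichZagierPeriods.Zeta5Search.WedgeDictionary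

/-- **(LD@N) for `W`**: the level-descent identity `levelDescentW` of `…WedgeDictionaryLevelDescent` holds. -/
theorem levelDescentW_holds : levelDescentW := (levelDescentWV_of_faceExt_holds coeffU_faceExt_holds).1

/-- **(LD@N) for `V`** (range `b₁ + b₂ + b₇ ≤ N`): the level-descent identity `levelDescentV` holds. -/
theorem levelDescentV_holds : levelDescentV := (levelDescentWV_of_faceExt_holds coeffU_faceExt_holds).2

/-- The box form for `W`: `ldBoxW` holds. -/
theorem ldBoxW_holds : ldBoxW := (ldBox_of_faceExt_holds coeffU_faceExt_holds).1

/-- The box form for `V`: `ldBoxV` holds. -/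
theorem ldBoxV_holds : ldBoxV := (ldBox_of_faceExt_holds coeffU_faceExt_holds).2

end Summit.KontsevichZagierPeriods.Zeta5Search.WedgeDictionary
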